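import Literature.Topology.PlaneTopology.WindingNumber
import Literature.Topology.PlaneTopology.JordanCurve
import Literature.Topology.PlaneTopology.Janiszewski
import Mathlib.Analysis.Complex.Tietze
import HarnessLib

/-!
# Eilenberg's separation criterion and the non-separation theorem for Jordan arcs

Topic: Topology / PlaneTopology. Second file of the proof of the Jordan curve theorem by
continuous logarithms (see `WindingNumber.lean`). For a compact set `K ⊆ ℂ` and points
`a, b ∉ K`:

* components of `ℂ \ K` are open with closure inside the component plus `K`, and of two
  distinct components at least one is bounded (`isBounded_or_isBounded_of_ne`);
* (**Eilenberg ⇒**) if `a` and `b` lie in the same component of `ℂ \ K` then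
  `z ↦ (z - a)/(z - b)` has a continuous logarithm on `K` — slide `a` to `b` along a path in
  `ℂ \ K` and lift the homotopy (`hasLogOn_div_sub_of_mem_connectedComponentIn`);
* (**independence lemma**) if the component `U` of `a` is bounded and `G` is continuous and
  nonvanishing on `Ū`, then `(z - a)^m G(z)` has a continuous logarithm on `K` only if `m = 0`:
  extend the logarithm to `ℂ` by Tietze, glue `e^{g} G⁻¹` on `Ū` with `(z - a)^m` off `U` (they
  agree on `∂U ⊆ K`) into a nonvanishing map on `ℂ`, which has a logarithm because `ℂ` is simply
  connected, and read it on a large circle about `a`, whose winding number is `m`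
  (`eq_zero_of_hasLogOn_zpow_mul`);
* (**Eilenberg's criterion**, Eilenberg 1936; Kuratowski, *Topology* II §61) `(z - a)/(z - b)`
  has a continuous logarithm on `K` iff `a` and `b` lie in the same component of `ℂ \ K`
  (`hasLogOn_div_sub_iff`);
* every nonvanishing map on an arc has a logarithm (path lifting), hence the **separation
  theorem for Jordan arcs**: `Literature.Topology.PlaneTopology.JordanArcSeparation` holds (`JordanArcSeparation_holds`),
  discharging the named fact of `JordanCurve.lean` [Mccleary2006, Ch. 9, p. 130].

Relation to `Literature/Topology/PlaneTopology/Janiszewski.lean` (Janiszewski's theorem by the same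
method, landed independently): that file already proves, in the unfolded `∃ g, ContinuousOn g K ∧ …`
form (definitionally `HasLogOn`), the easy direction (`Janiszewski.exists_log_of_mem_connectedComponentIn`,
by a clopen argument), the ratio case of the hard direction (`Janiszewski.not_exists_log_of_isBounded`),
`Janiszewski.frontier_connectedComponentIn_subset` and `Janiszewski.connectedComponentIn_eq_of_not_isBounded`;
we REUSE these (the corresponding statements below are one-line restatements in `HasLogOn` language) and
add what the Jordan curve theorem needs beyond Janiszewski: the independence lemma for
`(z - a)^m · G` with an arbitrary integer exponent (read through winding numbers, `WindingNumber.lean`),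
the two-sided criterion, and the arc theorem.

## References
* S. Eilenberg, Transformations continues en circonférence et la topologie du plan, Fund. Math.
  26 (1936) 61–112. [Eilenberg1936]
* J. McCleary, *A First Course in Topology*, AMS (2006), Ch. 9. [Mccleary2006]
-/

noncomputable section

namespace Literature.Topology.PlaneTopology

open Complex Set _root_.Topology Filter Metric Bornology
open scoped Real

/-! ### Components of the complement of a closed plane set -/

section Components

variable {K : Set ℂ} {a b : ℂ}

/-- Components of the complement of a closed set are open (the plane is locally connected).
[folklore] -/
theorem isOpen_connectedComponentIn_compl (hK : IsClosed K) (a : ℂ) :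
    IsOpen (connectedComponentIn Kᶜ a) :=
  hK.isOpen_compl.connectedComponentIn

/-- The closure of a complementary component of a closed set `K` lies in the component together
with `K`. [folklore] -/
theorem closure_connectedComponentIn_compl_subset (hK : IsClosed K) (a : ℂ) :
    closure (connectedComponentIn Kᶜ a) ⊆ connectedComponentIn Kᶜ a ∪ K := by
  intro z hz
  by_cases hzK : z ∈ K
  · exact Or.inr hzK
  left
  have hV : IsOpen (connectedComponentIn Kᶜ z) := hK.isOpen_compl.connectedComponentIn
  have hzV : z ∈ connectedComponentIn Kᶜ z := mem_connectedComponentIn hzK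
  obtain ⟨y, hyV, hyU⟩ := mem_closure_iff.1 hz _ hV hzV
  rw [connectedComponentIn_eq hyU, ← connectedComponentIn_eq hyV]
  exact hzV

/-- Of two distinct components of the complement of a compact set, at least one is bounded (the
unbounded points all lie in the component of the exterior region;
`Janiszewski.connectedComponentIn_eq_of_not_isBounded`). [folklore] -/
theorem isBounded_or_isBounded_of_ne (hK : IsCompact K)
    (hne : connectedComponentIn Kᶜ a ≠ connectedComponentIn Kᶜ b) :
    IsBounded (connectedComponentIn Kᶜ a) ∨ IsBounded (connectedComponentIn Kᶜ b) := by
  by_contra h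
  push Not at h
  exact hne (Janiszewski.connectedComponentIn_eq_of_not_isBounded hK h.1 h.2)

end Components

/-! ### Eilenberg's criterion -/

section Eilenberg

variable {K : Set ℂ} {a b : ℂ}

/-- **Eilenberg's criterion, easy direction.** If `b` lies in the component of `a` in `ℂ \ K`
(`K` closed) then `z ↦ (z - a)/(z - b)` has a continuous logarithm on `K`. This is
`Janiszewski.exists_log_of_mem_connectedComponentIn` (clopen argument along the component) read
in `HasLogOn` language; an alternative proof lifts the nonvanishing homotopy `(z - γ s)/(z - b)`
along a path `γ` from `a` to `b` (`hasLogOn_iff_of_homotopy`). [cite: Eilenberg1936] -/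
theorem hasLogOn_div_sub_of_mem_connectedComponentIn (hK : IsClosed K)
    (hb : b ∈ connectedComponentIn Kᶜ a) : HasLogOn (fun z => (z - a) / (z - b)) K :=
  Janiszewski.exists_log_of_mem_connectedComponentIn hK hb

/-- **Independence lemma** (the heart of Eilenberg's criterion). Let `K` be compact, `a ∉ K`
with *bounded* complementary component `U`, and `G` continuous and nonvanishing on `Ū`. If
`(z - a)^m · G z` has a continuous logarithm on `K` then `m = 0`. Proof: extend the logarithm
to `g ∈ C(ℂ, ℂ)` (Tietze); the map equal to `e^{g}/G` on `Ū` and to `(z - a)^m` off `U` is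
continuous (the two agree on `∂U ⊆ K`) and nonvanishing on `ℂ`, so has a logarithm (`ℂ` is
simply connected); on a circle about `a` enclosing `Ū` it is `(z - a)^m`, of winding number
`m`, so `m = 0`. [cite: Eilenberg1936] -/
theorem eq_zero_of_hasLogOn_zpow_mul (hK : IsCompact K) (ha : a ∉ K)
    (hUb : IsBounded (connectedComponentIn Kᶜ a)) {G : ℂ → ℂ}
    (hG : ContinuousOn G (closure (connectedComponentIn Kᶜ a)))
    (hG0 : ∀ z ∈ closure (connectedComponentIn Kᶜ a), G z ≠ 0) {m : ℤ}
    (h : HasLogOn (fun z => (z - a) ^ m * G z) K) : m = 0 := by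
  classical
  set U := connectedComponentIn Kᶜ a with hUdef
  have hKc : IsClosed K := hK.isClosed
  have hU : IsOpen U := isOpen_connectedComponentIn_compl hKc a
  have haU : a ∈ U := mem_connectedComponentIn ha
  have hfrU : frontier U ⊆ K := Janiszewski.frontier_connectedComponentIn_subset hKc a
  -- a circle about `a` enclosing `closure U`
  obtain ⟨R, hR0, hR⟩ : ∃ R, 0 < R ∧ closure U ⊆ ball a R := hUb.closure.subset_ball_lt 0 a
  -- Tietze extension of the logarithm
  obtain ⟨l, hl, hle⟩ := h
  obtain ⟨g, hg⟩ := ContinuousMap.exists_restrict_eq hKc (⟨fun x : K => l x, hl.restrict⟩ : C(K, ℂ))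
  have hgK : ∀ x ∈ K, g x = l x := fun x hx => by
    have := congrArg (fun F : C(K, ℂ) => F ⟨x, hx⟩) hg
    simpa using this
  -- the glued map
  let Φ : ℂ → ℂ := fun z => if z ∈ closure U then exp (g z) * (G z)⁻¹ else (z - a) ^ m
  have hΦc : Continuous Φ := by
    refine continuous_if ?_ ?_ ?_
    · intro z hz
      have hz' : z ∈ frontier (closure U) := hz
      have hzU : z ∈ frontier U := frontier_closure_subset hz'
      have hzK : z ∈ K := hfrU hzU
      have hzcl : z ∈ closure U := isClosed_closure.frontier_subset hz'
      rw [hgK z hzK, hle z hzK, mul_assoc, mul_inv_cancel₀ (hG0 z hzcl), mul_one]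
    · have : closure {z : ℂ | z ∈ closure U} = closure U := closure_closure
      rw [this]
      exact ((continuous_exp.comp g.continuous).continuousOn).mul (hG.inv₀ hG0)
    · refine ContinuousOn.zpow₀ (by fun_prop) m fun z hz => Or.inl ?_
      rw [sub_ne_zero]
      rintro rfl
      have : z ∉ closure {x : ℂ | x ∈ closure U}ᶜ := by
        change z ∉ closure (closure U)ᶜ
        rw [closure_compl, mem_compl_iff, not_not]
        exact interior_mono subset_closure (by rwa [hU.interior_eq])
      exact this hz
  have hΦ0 : ∀ z, Φ z ≠ 0 := by
    intro z
    by_cases hz : z ∈ closure U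
    · simp only [Φ, hz, if_true]
      exact mul_ne_zero (exp_ne_zero _) (inv_ne_zero (hG0 z hz))
    · simp only [Φ, hz, if_false]
      refine zpow_ne_zero m (sub_ne_zero.2 ?_)
      rintro rfl
      exact hz (subset_closure haU)
  -- global logarithm of Φ
  have hΦlog : HasLogOn Φ univ := hasLogOn_univ isSimplyConnected_univ_complex hΦc hΦ0
  -- on the circle, Φ is `(z - a) ^ m`
  have hcirc : ∀ t, Φ (circleLoop a R t) = (circleLoop a R t - a) ^ m := by
    intro t
    have : circleLoop a R t ∉ closure U := fun h' => by
      have := hR h'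
      rw [mem_ball, dist_eq_norm, norm_circleLoop_sub_center, abs_of_pos hR0] at this
      exact lt_irrefl _ this
    simp [Φ, this]
  have hw0 : wind (fun t => (circleLoop a R t - a) ^ m) = 0 := by
    rw [← wind_comp_eq_zero_of_hasLogOn (γ := circleLoop a R) hΦlog
      (continuous_circleLoop a R).continuousOn (mapsTo_univ _ _) (circleLoop_zero_eq a R)]
    exact wind_congr fun t _ => (hcirc t).symm
  have hloop : IsNonvanishingLoop fun t => circleLoop a R t - a := by
    have e : (fun t => circleLoop a R t - a) = circleLoop 0 R :=
      funext fun t => by rw [circleLoop_sub, sub_self]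
    rw [e]
    exact isNonvanishingLoop_circleLoop (by simp [abs_of_pos hR0, hR0.ne])
  have hw1 : wind (fun t => (circleLoop a R t - a) ^ m) = m := by
    rw [wind_zpow hloop, wind_circleLoop_sub_of_norm_lt (by simpa using hR0), mul_one]
  rw [hw0] at hw1
  exact hw1.symm

/-- **Eilenberg's criterion, hard direction** (one-sided form): if the component of `a` in
`ℂ \ K` is bounded and does not contain `b ∉ K`, then `(z - a)/(z - b)` has no continuous
logarithm on the compact set `K`. This is `Janiszewski.not_exists_log_of_isBounded` (Borsuk's
criterion) in `HasLogOn` language; it is also the case `m = 1`, `G = (z - b)⁻¹` of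
`eq_zero_of_hasLogOn_zpow_mul`. [cite: Eilenberg1936] -/
theorem not_hasLogOn_div_sub (hK : IsCompact K) (ha : a ∉ K) (hb : b ∉ K)
    (hUa : IsBounded (connectedComponentIn Kᶜ a)) (hbU : b ∉ connectedComponentIn Kᶜ a) :
    ¬ HasLogOn (fun z => (z - a) / (z - b)) K :=
  Janiszewski.not_exists_log_of_isBounded hK ha hUa hbU hb

/-- **Eilenberg's criterion** (S. Eilenberg 1936; K. Borsuk): for a compact `K ⊆ ℂ` and
`a, b ∉ K`, the map `z ↦ (z - a)/(z - b)` has a continuous logarithm on `K` if and only if `a`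
and `b` lie in the same component of `ℂ \ K`. [cite: Eilenberg1936] -/
theorem hasLogOn_div_sub_iff (hK : IsCompact K) (ha : a ∉ K) (hb : b ∉ K) :
    HasLogOn (fun z => (z - a) / (z - b)) K ↔
      connectedComponentIn Kᶜ a = connectedComponentIn Kᶜ b := by
  refine ⟨fun h => ?_, fun h => hasLogOn_div_sub_of_mem_connectedComponentIn hK.isClosed
    (h ▸ mem_connectedComponentIn hb)⟩
  by_contra hne
  rcases isBounded_or_isBounded_of_ne hK hne with hUa | hUb
  · exact not_hasLogOn_div_sub hK ha hb hUa (fun hbU => hne (connectedComponentIn_eq hbU)) h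
  · refine not_hasLogOn_div_sub hK hb ha hUb
      (fun haU => hne (connectedComponentIn_eq haU).symm) (h.inv.congr fun z _ => ?_)
    simp [inv_div]

/-- In particular `z ↦ z - a` has no continuous logarithm on `K` when the component of `a` in
`ℂ \ K` is bounded (`K` "winds around" `a`). [cite: Eilenberg1936] -/
theorem not_hasLogOn_sub (hK : IsCompact K) (ha : a ∉ K)
    (hUa : IsBounded (connectedComponentIn Kᶜ a)) : ¬ HasLogOn (fun z => z - a) K := by
  intro h
  have := eq_zero_of_hasLogOn_zpow_mul hK ha hUa (G := fun _ => (1 : ℂ)) (m := 1)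
    continuousOn_const (fun _ _ => one_ne_zero) (h.congr fun z _ => by simp)
  exact one_ne_zero this

end Eilenberg

/-! ### Arcs do not separate the plane -/

/-- Every continuous nonvanishing map on an arc `Λ ≅ [0, 1]` has a continuous logarithm (lift
along the parametrisation). [folklore] -/
theorem hasLogOn_of_homeomorph_unitInterval {Λ : Set ℂ} (e : unitInterval ≃ₜ Λ) {F : ℂ → ℂ}
    (hF : ContinuousOn F Λ) (hF0 : ∀ z ∈ Λ, F z ≠ 0) : HasLogOn F Λ := by
  classical
  let φ : ℝ → ℂ := fun t => F (e (projIcc 0 1 zero_le_one t))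
  have hφc : Continuous φ :=
    hF.comp_continuous (continuous_subtype_val.comp (e.continuous.comp continuous_projIcc))
      fun t => (e _).2
  have hφ0 : ∀ t, φ t ≠ 0 := fun t => hF0 _ (e _).2
  obtain ⟨ψ, hψ, hψe⟩ := hasLogOn_univ isSimplyConnected_univ_real hφc hφ0
  refine ⟨fun z => if hz : z ∈ Λ then ψ (e.symm ⟨z, hz⟩) else 0, ?_, fun z hz => ?_⟩
  · rw [continuousOn_iff_continuous_restrict]
    have : (Λ.restrict fun z => if hz : z ∈ Λ then ψ (e.symm ⟨z, hz⟩) else 0) =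
        fun w => ψ (e.symm w) := by
      ext w
      simp [w.2]
    rw [this]
    exact (continuousOn_univ.1 hψ).comp (continuous_subtype_val.comp e.symm.continuous)
  · simp only [hz, dif_pos]
    rw [hψe _ (mem_univ _)]
    show F (e (projIcc 0 1 zero_le_one (e.symm ⟨z, hz⟩ : ℝ))) = F z
    rw [projIcc_val zero_le_one (e.symm ⟨z, hz⟩), e.apply_symm_apply]

/-- A set homeomorphic to `[0, 1]` is compact. [folklore] -/
theorem isCompact_of_homeomorph_unitInterval {Λ : Set ℂ} (e : unitInterval ≃ₜ Λ) :
    IsCompact Λ := by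
  have : CompactSpace Λ := e.compactSpace
  exact isCompact_iff_compactSpace.2 this

/-- **Separation theorem for Jordan arcs** (McCleary, *A First Course in Topology* (2006),
Ch. 9, p. 130): a subset of the plane homeomorphic to `[0, 1]` does not separate the plane.
Proof: for `a, b ∉ Λ` the map `(z - a)/(z - b)` has a logarithm on the arc `Λ` (every
nonvanishing map on an arc does), so by Eilenberg's criterion `a` and `b` lie in the same
component of `ℂ \ Λ`. This discharges the named fact `Literature.Topology.PlaneTopology.JordanArcSeparation`.
[cite: Mccleary2006, Ch. 9, p. 130 (Separation Theorem for Jordan arcs)] -/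
theorem JordanArcSeparation_holds : JordanArcSeparation := by
  rintro Λ ⟨e⟩
  have hΛc : IsCompact Λ := isCompact_of_homeomorph_unitInterval e
  obtain ⟨R, hR, hΛR⟩ := hΛc.isBounded.subset_ball_lt 0 0
  have hw : ((R : ℝ) : ℂ) ∉ Λ := fun h => by
    have := hΛR h
    rw [mem_ball_zero_iff, norm_real, Real.norm_eq_abs, abs_of_pos hR] at this
    exact lt_irrefl _ this
  have key : ∀ a ∉ Λ, ∀ b ∉ Λ, connectedComponentIn Λᶜ a = connectedComponentIn Λᶜ b := by
    intro a ha b hb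
    have hzb : ∀ z ∈ Λ, z - b ≠ 0 := fun z hz => sub_ne_zero.2 fun h => hb (h ▸ hz)
    have hza : ∀ z ∈ Λ, z - a ≠ 0 := fun z hz => sub_ne_zero.2 fun h => ha (h ▸ hz)
    exact (hasLogOn_div_sub_iff hΛc ha hb).1 (hasLogOn_of_homeomorph_unitInterval e
      (ContinuousOn.div (by fun_prop) (by fun_prop) hzb)
      fun z hz => div_ne_zero (hza z hz) (hzb z hz))
  refine ⟨⟨R, hw⟩, ?_⟩
  have : Λᶜ = connectedComponentIn Λᶜ R := by
    refine Subset.antisymm (fun z hz => ?_) (connectedComponentIn_subset _ _)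
    rw [key _ hw z hz]
    exact mem_connectedComponentIn hz
  rw [this]
  exact isPreconnected_connectedComponentIn

end Literature.Topology.PlaneTopology
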